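import Summits.BirchSwinnertonDyer.BirchSwinnertonDyer.Theorems.PrintCf2DisegniPairTwoChiLineValuesTwo
import Literature.NumberTheory.EllipticCurves.PAdicLFunctionMinus
import Literature.NumberTheory.EllipticCurves.PAdicLFunctionMinusMultFunctionalEquationProofs
import Literature.NumberTheory.EllipticCurves.PAdicLFunctionIntegralityAtTwoProofs
import HarnessLib

/-!
# Road (C) `disegni-pair-two` on crux stmt-BirchSwinnertonDyer-20368 — STEP A₂⁻: Disegni's interpolation
# values at ODD points (the `χ₋₄ ∘ N`-line at `p = 2`, `d* = −1`) are a constant times two MINUS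
# Mazur–Tate–Teitelbaum values

Cell `bsd-print-cf2`, width seat `bsd-line-cf2-p1-w8` g21; sibling of `…ChiLineValues` (§1, EVEN points,
plus symbols) and `…ChiLineValuesTwo` (the `χ₈∘N`-line, `d* = 2`). THEOREMS ONLY (no `def`, no named
fact, no `sorry`); `--supports stmt-BirchSwinnertonDyer-20368`. BSD is not proved by any of this. Of the
three road-(C) twisting characters `ε_{d*}`, `d* ∈ {−1, 2, −2}`, the two ODD ones (`χ₋₄`, `χ₋₈`) are
read on the tree's MINUS Mazur–Swinnerton-Dyer objects (`Literature/…/PAdicLFunctionMinus.lean`: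
`ratMinusSymbol`, `padicLFunctionMinusBranch f α i`, Birch's formula for ODD characters
`ratMinusTwistedSymbolSum_mul_minusPeriod_mul_I` — PROVED there). This file is the odd twin of STEP A₂:

§1 (any `p` split in the quadratic `K`): `chiLineComplexPart_eq_of_isPrimitive_odd` — at a RAMIFIED ODD
point `ξ` (primitive, odd, mod `p^n`, `n ≥ 1`): `ι⁻¹(Z°_p(ξ∘N)·Car·Λ₁(1)Λ₂(1)) = c⁻ · v⁻_f(χ_ξ) ·
v⁻_{f′}(χ_ξ)`, `c⁻ = ι⁻¹(−u·Car·Ω⁻_f·Ω⁻_{f′})` (the sign from `(Ω⁻i)² = −(Ω⁻)²`), `v⁻_g(χ_ξ) =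
α^{−n}Σ_b χ_ξ(b)[b/p^n]⁻_g` — Disegni's `Z°_p = u·a^{−2n}τ(ξ⁻¹)²` (`zCirc_baseChangeDirichlet_of_isPrimitive`)
and Birch-odd at `ξ⁻¹`.
§2 (`p = 2`, the `χ₋₄∘N`-line): `χ₄ = χ₋₄` (Mathlib `ZMod.χ₄`) is odd and primitive of conductor `4`;
`θ·χ₄` is primitive and odd for `θ` primitive even mod `2^{m+1}`, `m ≥ 2`; the line character is
`χ₄∘N · θ∘N = (θχ₄)∘N` (`baseChangeDirichlet_mul_changeLevel`, any twisting character); and the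
MTT WEIGHT of the odd branch at `2`: `ω = χ₋₄` on `ℤ/4` — `teichWeight 2 1 (a mod 4) = χ₄(a)`
(`algebraMap_teichWeight_two_one`), so that `Σ_a χ_θ(a)ω(a)[a/2^{m+1}]⁻ = Σ_a χ_{θχ₄}(a)[a/2^{m+1}]⁻`
(`sum_twin_mul_teichWeight_eq_ratMinusTwistedSymbolSum`): the odd-branch interpolation sum of
`hasSum_padicLMinusBranchCoeff_mul_pow_of_isPrimitive` at `κ = χ_θ` IS `v⁻_g(χ_{θχ₄})` — at the SAME
point `T = χ_θ(5) − 1` (no reflection, unlike `d* = ±2`).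
(STEP A₂⁻ proper — `chiLineValue` at the points of the `χ₋₄∘N`-line — and the factorisation are the
sibling files `…ChiLinePointwiseOdd` / `…ChiLineFactorisationOdd`.)

References: [Disegni2017] Thm. A (arXiv v3 PDF pp. 6–7); [MazurTateTeitelbaum1986Invent] §I.8 (8.6),
§I.10 (10.1), §I.13, §I.14 (14.3); [CremonaAlgorithms1997] §2.8 (`Ω⁻`); cell PREGRADE
`bsd-print-cf2-plan/PREGRADE-disegni-pair-two-skeleton-g24.md` §5.
-/

set_option autoImplicit false
set_option linter.dupNamespace false

noncomputable section

open scoped Classical MatrixGroups ModularForm NumberField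

open CongruenceSubgroup NumberField IsDedekindDomain Literature.NumberTheory.EllipticCurves
  Literature.NumberTheory.EllipticCurves.ModularForms
  Literature.NumberTheory.EllipticCurves.Disegni2017 Literature.NumberTheory.GaloisRepresentations

namespace Summit.BirchSwinnertonDyer.BirchSwinnertonDyer.Theorems.PrintCf2.DisegniPairTwo

/-! ### §1 The value identity at a ramified ODD point (any `p`) -/

section AnyPrimeOdd

variable {p : ℕ} [hp : Fact p.Prime] (ι : PadicAlgCl p ≃+* ℂ)
  (K : Type) [Field K] [NumberField K] [IsGalois ℚ K]

/-- **Transport of a MINUS twisted symbol sum along `ι⁻¹`**: `ι⁻¹(Σ_b ξ⁻¹(b)[b/m]⁻_g) = Σ_b χ_ξ(b)[b/m]⁻_g`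
in `ℂ_p` (`[b/m]⁻_g ∈ ℚ`). [cite: MazurTateTeitelbaum1986Invent, §I.8 (8.6) and §I.13] -/
theorem coe_symm_ratMinusTwistedSymbolSum_inv {m : ℕ} [NeZero m] {N : ℕ} (g : CuspForm (Gamma0 N) 2)
    (ξ : DirichletCharacter ℂ m) :
    ((ι.symm (ratMinusTwistedSymbolSum g ξ⁻¹) : PadicAlgCl p) : ℂ_[p]) =
      ratMinusTwistedSymbolSum g
        ((ξ⁻¹.ringHomComp ι.symm.toRingHom).ringHomComp (algebraMap (PadicAlgCl p) ℂ_[p])) := by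
  rw [ratMinusTwistedSymbolSum, ratMinusTwistedSymbolSum, map_sum, PadicComplex.coe_eq, map_sum]
  refine Finset.sum_congr rfl fun b _ ↦ ?_
  rw [map_mul, map_mul, MulChar.ringHomComp_apply, MulChar.ringHomComp_apply, map_ratCast,
    map_ratCast]
  rfl

/-- The inverse of a primitive character is primitive. [folklore] -/
private theorem isPrimitive_inv'' {m : ℕ} [NeZero m] {ξ : DirichletCharacter ℂ m} (hξ : ξ.IsPrimitive) :
    ξ⁻¹.IsPrimitive := by
  rw [DirichletCharacter.isPrimitive_def, DirichletCharacter.conductor_inv]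
  exact hξ

/-- The inverse of an odd character is odd. [folklore] -/
private theorem odd_inv' {m : ℕ} {ξ : DirichletCharacter ℂ m} (hξ : ξ.Odd) : ξ⁻¹.Odd := by
  rw [DirichletCharacter.Odd, MulChar.inv_apply_eq_inv', hξ, inv_neg, inv_one]

/-- `ι⁻¹(ι(α)⁻¹ ^ n) = α⁻¹ ^ n` read in `ℂ_p` (`α ∈ ℚ_p`). [folklore] -/
private theorem coe_symm_inv_pow' (α : ℚ_[p]) (n : ℕ) :
    ((ι.symm ((ι ((α : PadicAlgCl p)))⁻¹ ^ n) : PadicAlgCl p) : ℂ_[p]) =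
      algebraMap ℚ_[p] ℂ_[p] (α⁻¹ ^ n) := by
  rw [map_pow, map_inv₀, RingEquiv.symm_apply_apply, PadicComplex.coe_eq, map_pow, map_inv₀,
    map_pow, map_inv₀]
  change ((algebraMap (PadicAlgCl p) ℂ_[p]) ((algebraMap ℚ_[p] (PadicAlgCl p)) α))⁻¹ ^ n = _
  rw [← IsScalarTower.algebraMap_apply]

/-- ★ **STEP A at a RAMIFIED ODD point of a base-change line** (`p` split in the quadratic `K`,
`𝔭, 𝔭′ ∋ p`; `ξ` PRIMITIVE and ODD mod `p^n`, `n ≥ 1`; `f`, `f′` rational newforms; `α ∈ ℚ_p`,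
`a = ι(α)`): for ANY entire continuations `Λ₁`, `Λ₂` of `L(f⊗ξ, s)`, `L(f′⊗ξ, s)`,
`ι⁻¹( Z°_p(ξ∘N)·Car·Λ₁(1)Λ₂(1) ) = ι⁻¹(−u·Car·Ω⁻_f·Ω⁻_{f′}) · (α^{−n}Σ_b χ_ξ(b)[b/p^n]⁻_f) ·
(α^{−n}Σ_b χ_ξ(b)[b/p^n]⁻_{f′})` — Disegni's `Z°_p = u·a^{−2n}·τ(ξ⁻¹)²`, Birch's formula for the ODD
primitive `ξ⁻¹` (`Σ_b ξ⁻¹(b)[b/p^n]⁻_g · Ω⁻_g · i = τ(ξ⁻¹) Λ_g(1)`, `i² = −1`), transport along `ι⁻¹`.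
The right-hand factors are EXACTLY the values of the MINUS-branch interpolation theorem
`hasSum_padicLMinusBranchCoeff_mul_pow_of_isPrimitive` once its weight `ω(a)^i` is absorbed into the
character (`p = 2`, `i = 1`: §2). [cite: Disegni2017, Theorem A (arXiv v3 PDF p. 6 L42–59, p. 7 L1–6)]
[cite: MazurTateTeitelbaum1986Invent, §I.8 (8.6), §I.14 (14.3)] -/
theorem chiLineComplexPart_eq_of_isPrimitive_odd (h2 : Module.finrank ℚ K = 2)
    (hsplit : ((Ideal.span {(p : ℤ)}).primesOver (𝓞 K)).ncard = 2)
    (𝔭 𝔭' : HeightOneSpectrum (𝓞 K)) (h𝔭 : ((p : ℕ) : 𝓞 K) ∈ 𝔭.asIdeal)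
    (h𝔭' : ((p : ℕ) : 𝓞 K) ∈ 𝔭'.asIdeal) {n : ℕ} (hn : 0 < n) [NeZero (p ^ n)]
    {ξ : DirichletCharacter ℂ (p ^ n)} (hξ : ξ.IsPrimitive) (hξo : ξ.Odd)
    {N N' : ℕ} [NeZero N] [NeZero N'] {f : CuspForm (Gamma0 N) 2} {f' : CuspForm (Gamma0 N') 2}
    (hf : IsNewform0 f) (hQ : coeffField f = ⊥) (hf' : IsNewform0 f') (hQ' : coeffField f' = ⊥)
    (α : ℚ_[p]) (Car : ℝ) {Λ₁ Λ₂ : ℂ → ℂ} (hΛ₁ : Differentiable ℂ Λ₁)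
    (hΛ₁' : ∀ s : ℂ, 2 < s.re → Λ₁ s = twistedLSeries f ξ s) (hΛ₂ : Differentiable ℂ Λ₂)
    (hΛ₂' : ∀ s : ℂ, 2 < s.re → Λ₂ s = twistedLSeries f' ξ s) :
    ((ι.symm (zCirc (p := p) (ι ((α : PadicAlgCl p))) N (baseChangeDirichlet K ξ) 𝔭 𝔭' * (Car : ℂ) *
        (Λ₁ 1 * Λ₂ 1)) : PadicAlgCl p) : ℂ_[p]) =
      ((ι.symm (-(splitLocalConstant p : ℂ) * (Car : ℂ) * (minusPeriod f : ℂ) * (minusPeriod f' : ℂ)) :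
          PadicAlgCl p) : ℂ_[p]) *
        (algebraMap ℚ_[p] ℂ_[p] (α⁻¹ ^ n) *
          ratMinusTwistedSymbolSum f
            ((ξ⁻¹.ringHomComp ι.symm.toRingHom).ringHomComp (algebraMap (PadicAlgCl p) ℂ_[p]))) *
        (algebraMap ℚ_[p] ℂ_[p] (α⁻¹ ^ n) *
          ratMinusTwistedSymbolSum f'
            ((ξ⁻¹.ringHomComp ι.symm.toRingHom).ringHomComp (algebraMap (PadicAlgCl p) ℂ_[p]))) := by
  set a : ℂ := ι ((α : PadicAlgCl p)) with ha
  set τ : ℂ := gaussSum ξ⁻¹ (ZMod.stdAddChar (N := p ^ n)) with hτ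
  -- Birch's formula at the odd primitive character `ξ⁻¹` (`(ξ⁻¹)⁻¹ = ξ`)
  have hB₁ := ratMinusTwistedSymbolSum_mul_minusPeriod_mul_I f hf hQ (isPrimitive_inv'' hξ) (odd_inv' hξo)
    hΛ₁ (fun s hs ↦ by rw [inv_inv]; exact hΛ₁' s hs)
  have hB₂ := ratMinusTwistedSymbolSum_mul_minusPeriod_mul_I f' hf' hQ' (isPrimitive_inv'' hξ) (odd_inv' hξo)
    hΛ₂ (fun s hs ↦ by rw [inv_inv]; exact hΛ₂' s hs)
  -- the complex identity
  have hC : zCirc (p := p) a N (baseChangeDirichlet K ξ) 𝔭 𝔭' * (Car : ℂ) * (Λ₁ 1 * Λ₂ 1) =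
      (-(splitLocalConstant p : ℂ) * (Car : ℂ) * (minusPeriod f : ℂ) * (minusPeriod f' : ℂ)) *
        (a⁻¹ ^ n * ratMinusTwistedSymbolSum f ξ⁻¹) * (a⁻¹ ^ n * ratMinusTwistedSymbolSum f' ξ⁻¹) := by
    rw [zCirc_baseChangeDirichlet_of_isPrimitive h2 hsplit hn hξ a N 𝔭 𝔭' h𝔭 h𝔭', ← hτ]
    have hI : Complex.I * Complex.I = -1 := Complex.I_mul_I
    calc (splitLocalConstant p : ℂ) * (a⁻¹ ^ n * τ) ^ 2 * (Car : ℂ) * (Λ₁ 1 * Λ₂ 1)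
        = -(Complex.I * Complex.I) * (splitLocalConstant p : ℂ) * (Car : ℂ) * (a⁻¹ ^ n) ^ 2 *
            (τ * Λ₁ 1) * (τ * Λ₂ 1) := by rw [hI]; ring
      _ = -(Complex.I * Complex.I) * (splitLocalConstant p : ℂ) * (Car : ℂ) * (a⁻¹ ^ n) ^ 2 *
            (ratMinusTwistedSymbolSum f ξ⁻¹ * (minusPeriod f : ℂ) * Complex.I) *
            (ratMinusTwistedSymbolSum f' ξ⁻¹ * (minusPeriod f' : ℂ) * Complex.I) := by rw [hB₁, hB₂]
      _ = -(Complex.I * Complex.I) * (Complex.I * Complex.I) *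
            ((splitLocalConstant p : ℂ) * (Car : ℂ) * (minusPeriod f : ℂ) * (minusPeriod f' : ℂ)) *
            (a⁻¹ ^ n * ratMinusTwistedSymbolSum f ξ⁻¹) * (a⁻¹ ^ n * ratMinusTwistedSymbolSum f' ξ⁻¹) := by
          ring
      _ = _ := by rw [hI]; ring
  have hφ : ∀ x y : ℂ, ((ι.symm (x * y) : PadicAlgCl p) : ℂ_[p]) =
      ((ι.symm x : PadicAlgCl p) : ℂ_[p]) * ((ι.symm y : PadicAlgCl p) : ℂ_[p]) := fun x y ↦ by
    rw [map_mul, PadicComplex.coe_eq, map_mul, ← PadicComplex.coe_eq, ← PadicComplex.coe_eq]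
  rw [hC, hφ _ (a⁻¹ ^ n * ratMinusTwistedSymbolSum f' ξ⁻¹), hφ _ (a⁻¹ ^ n * ratMinusTwistedSymbolSum f ξ⁻¹),
    hφ (a⁻¹ ^ n) (ratMinusTwistedSymbolSum f ξ⁻¹), hφ (a⁻¹ ^ n) (ratMinusTwistedSymbolSum f' ξ⁻¹), ha,
    coe_symm_inv_pow', coe_symm_ratMinusTwistedSymbolSum_inv, coe_symm_ratMinusTwistedSymbolSum_inv]

end AnyPrimeOdd

/-! ### §2 `p = 2`: the points of the `χ₋₄ ∘ N`-line, and the weight of the odd branch -/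

section TwoOddPoints

/-- **`χ₄ = χ₋₄ ⊗ ℂ` is ODD** (`χ₄(−1) = χ₄(3) = −1`), at any level `2^{m+1} ≥ 4` and at level `4 = 2²`.
[cite: MontgomeryVaughan2007, §9.1] -/
theorem chi4_changeLevel_odd {m : ℕ} (h4 : 4 ∣ 2 ^ (m + 1)) :
    (DirichletCharacter.changeLevel h4 (ZMod.χ₄.ringHomComp (Int.castRingHom ℂ))).Odd := by
  have hcop : IsCoprime (-1 : ℤ) ((2 ^ (m + 1) : ℕ) : ℤ) := isCoprime_one_left.neg_left
  rw [DirichletCharacter.Odd, show (-1 : ZMod (2 ^ (m + 1))) = ((-1 : ℤ) : ZMod (2 ^ (m + 1))) by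
    rw [Int.cast_neg, Int.cast_one], DirichletCharacter.changeLevel_eq_cast_of_dvd' _ h4 hcop,
    Int.cast_neg, Int.cast_one, MulChar.ringHomComp_apply]
  have h : ZMod.χ₄ (-1 : ZMod 4) = -1 := by decide
  rw [h, map_neg, map_one]

/-- `χ₄ ⊗ ℂ` at level `2²` is odd. [cite: MontgomeryVaughan2007, §9.1] -/
theorem chi4_odd : DirichletCharacter.Odd (ZMod.χ₄.ringHomComp (Int.castRingHom ℂ) : DirichletCharacter ℂ (2 ^ 2)) := by
  show (ZMod.χ₄.ringHomComp (Int.castRingHom ℂ)) (-1 : ZMod 4) = -1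
  rw [MulChar.ringHomComp_apply]
  have h : ZMod.χ₄ (-1 : ZMod 4) = -1 := by decide
  rw [h, map_neg, map_one]

/-- **`χ₄ ⊗ ℂ` is PRIMITIVE of conductor `4`**: its conductor divides `4` but not `2`, since `χ₄(3) = −1`
and `3 ≡ 1 (mod 2)`. [cite: MontgomeryVaughan2007, §9.1 (primitive characters)] -/
theorem chi4_isPrimitive :
    DirichletCharacter.IsPrimitive (ZMod.χ₄.ringHomComp (Int.castRingHom ℂ) : DirichletCharacter ℂ (2 ^ 2)) := by
  set χ : DirichletCharacter ℂ (2 ^ 2) := ZMod.χ₄.ringHomComp (Int.castRingHom ℂ) with hχ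
  have h3 : χ (3 : ZMod (2 ^ 2)) = -1 := by
    rw [hχ, MulChar.ringHomComp_apply, show ZMod.χ₄ (3 : ZMod (2 ^ 2)) = -1 by decide, map_neg, map_one]
  rw [DirichletCharacter.isPrimitive_def]
  have hdvd : χ.conductor ∣ 2 ^ 2 := χ.conductor_dvd_level
  have hnot : ¬ χ.conductor ∣ 2 := by
    intro h2
    have hmem : 2 ∈ χ.conductorSet :=
      (χ.mem_conductorSet_iff_conductor_dvd (show 2 ∣ 2 ^ 2 by norm_num)).mpr h2
    obtain ⟨hd, χ₀, hχ₀⟩ := (χ.mem_conductorSet_iff.mp hmem)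
    have hcop : IsCoprime (3 : ℤ) ((2 ^ 2 : ℕ) : ℤ) := by
      rw [Int.isCoprime_iff_gcd_eq_one]; decide
    have h3' : χ (3 : ℤ) = χ₀ (3 : ℤ) := by
      rw [hχ₀, DirichletCharacter.changeLevel_eq_cast_of_dvd' χ₀ hd hcop]
    have h31 : ((3 : ℤ) : ZMod 2) = 1 := by decide
    rw [h31, map_one, show ((3 : ℤ) : ZMod (2 ^ 2)) = 3 by rfl, h3] at h3'
    exact Ring.neg_one_ne_one_of_char_ne_two (by rw [ringChar.eq_zero]; norm_num) h3'
  obtain ⟨k, hk, hk'⟩ := (Nat.dvd_prime_pow Nat.prime_two).mp hdvd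
  interval_cases k
  · exact absurd (hk' ▸ one_dvd 2) hnot
  · exact absurd (hk' ▸ dvd_refl 2) hnot
  · rw [hk']; norm_num

/-- **`θ · χ₄` is PRIMITIVE mod `2^{m+1}` for `θ` primitive and `m ≥ 2`** (`χ₄` has conductor `4 ∣ 2^m`,
so it cannot lower the conductor of `θ`; `χ₄² = 1`). [cite: MontgomeryVaughan2007, §9.1 (primitive characters)] -/
theorem isPrimitive_mul_chi4_changeLevel {m : ℕ} (hm : 2 ≤ m) (h4 : 4 ∣ 2 ^ (m + 1))
    {θ : DirichletCharacter ℂ (2 ^ (m + 1))} (hθ : θ.IsPrimitive) :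
    (θ * DirichletCharacter.changeLevel h4 (ZMod.χ₄.ringHomComp (Int.castRingHom ℂ))).IsPrimitive := by
  set ε := DirichletCharacter.changeLevel h4 (ZMod.χ₄.ringHomComp (Int.castRingHom ℂ)) with hε
  set ϑ := θ * ε with hϑ
  rw [DirichletCharacter.isPrimitive_def]
  by_contra hne
  have hdvd : ϑ.conductor ∣ 2 ^ (m + 1) := DirichletCharacter.conductor_dvd_level _
  obtain ⟨k, hk, hkeq⟩ := (Nat.dvd_prime_pow Nat.prime_two).mp hdvd
  have hkm : k ≤ m := by
    by_contra hkm
    exact hne (by rw [hkeq, show k = m + 1 by omega])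
  have hϑm : ϑ.conductor ∣ 2 ^ m := by rw [hkeq]; exact pow_dvd_pow 2 hkm
  have h4m : 4 ∣ 2 ^ m := by
    rw [show (4 : ℕ) = 2 ^ 2 by norm_num]; exact pow_dvd_pow 2 hm
  have hεfac : ε.FactorsThrough 4 :=
    DirichletCharacter.changeLevel_factorsThrough (ZMod.χ₄.ringHomComp (Int.castRingHom ℂ)) h4
  have hεm : ε.conductor ∣ 2 ^ m :=
    (DirichletCharacter.conductor_dvd_of_mem_conductorSet _ hεfac).trans h4m
  have hεε : ε * ε = 1 := by
    rw [hε, ← map_mul, ← sq, (ZMod.isQuadratic_χ₄.comp _).sq_eq_one, map_one]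
  have hθeq : θ = ϑ * ε := by rw [hϑ, mul_assoc, hεε, mul_one]
  have hcond : θ.conductor ∣ 2 ^ m := by
    rw [hθeq]
    exact (DirichletCharacter.conductor_mul_dvd_lcm_conductor ϑ ε).trans (Nat.lcm_dvd hϑm hεm)
  rw [hθ] at hcond
  have := (Nat.pow_dvd_pow_iff_le_right (by norm_num : 1 < 2)).mp hcond
  omega

/-- An even `θ` times `χ₄` is ODD. [cite: MontgomeryVaughan2007, §9.1] -/
theorem odd_mul_chi4_changeLevel {m : ℕ} (h4 : 4 ∣ 2 ^ (m + 1))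
    {θ : DirichletCharacter ℂ (2 ^ (m + 1))} (heven : θ.Even) :
    (θ * DirichletCharacter.changeLevel h4 (ZMod.χ₄.ringHomComp (Int.castRingHom ℂ))).Odd := by
  rw [DirichletCharacter.Odd, MulChar.coeToFun_mul, Pi.mul_apply, heven, one_mul]
  exact chi4_changeLevel_odd h4

variable (ι : PadicAlgCl 2 ≃+* ℂ) (K : Type) [Field K] [NumberField K] [IsGalois ℚ K]

/-- **The line character at a point of a base-change line**: for any Dirichlet character `ε` mod `d` and
`θ` mod `n` with `d ∣ n`, `ε∘N · θ∘N = (θ·ε)∘N` with `ε` raised to level `n`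
(`HeckeCharacter.ofDirichlet_mul`, `HeckeCharacter.ofDirichlet_changeLevel`). The `χ₈` case is
`baseChangeDirichlet_chi8_mul`. [cite: Disegni2017, §1.2 (arXiv v3 PDF p. 6)] [cite: NeukirchANT1999, Ch. VII §6 Prop. (6.9)] -/
theorem baseChangeDirichlet_mul_changeLevel {d n : ℕ} [NeZero d] [NeZero n] (h : d ∣ n)
    (ε : DirichletCharacter ℂ d) (θ : DirichletCharacter ℂ n) :
    baseChangeDirichlet K ε * baseChangeDirichlet K θ =
      baseChangeDirichlet K (θ * DirichletCharacter.changeLevel h ε) := by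
  rw [baseChangeDirichlet_def, baseChangeDirichlet_def, baseChangeDirichlet_def,
    ← HeckeCharacter.ofDirichlet_changeLevel h, ← HeckeCharacter.compRelNorm_mul,
    ← HeckeCharacter.ofDirichlet_mul, mul_comm]

/-- The `2`-adic roots of unity of order dividing `τ₂ = 2` are `1` and `−1`. [folklore] -/
private theorem rootsOfUnity_torsionOrder_two_eq (w : rootsOfUnity (torsionOrder 2) ℤ_[2]) :
    w = 1 ∨ w = ⟨-1, neg_one_mem_rootsOfUnity_torsionOrder 2⟩ := by
  have h := (mem_rootsOfUnity _ _).mp w.2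
  simp only [torsionOrder_two] at h
  have h' : (((w : ℤ_[2]ˣ) : ℤ_[2])) ^ 2 = 1 := by
    rw [← Units.val_pow_eq_pow_val, h, Units.val_one]
  rcases sq_eq_one_iff.mp h' with h1 | h1
  · left
    exact Subtype.ext (Units.ext h1)
  · right
    exact Subtype.ext (Units.ext h1)

/-- **The weight of the odd branch at `2` is `χ₋₄`**: for `a` mod `2^{m+1}` (`m + 1 ≥ e₀ = 2`),
`ι₂(ω(a mod 4)) = χ₄(a mod 4)` in `ℂ₂` — the Teichmüller character of `ℤ₂^× = {±1} × (1+4ℤ₂)` is the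
sign `a ≡ ±1 (mod 4)`, and both sides vanish on even `a`. [cite: MazurTateTeitelbaum1986Invent, §I.13]
[cite: Washington1997, §5.1] -/
theorem algebraMap_teichWeight_two_one {m : ℕ} (hm : cyclotomicExponent 2 ≤ m + 1)
    (h4 : 4 ∣ 2 ^ (m + 1)) (a : ZMod (2 ^ (m + 1))) :
    algebraMap ℚ_[2] ℂ_[2] (teichWeight 2 1
        (ZMod.castHom (pow_dvd_pow 2 hm) (ZMod (2 ^ cyclotomicExponent 2)) a)) =
      ((ZMod.χ₄ (ZMod.castHom h4 (ZMod 4) a) : ℤ) : ℂ_[2]) := by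
  -- the cast `ZMod (2^{e₀}) → ZMod 4` (`e₀ = 2`)
  have h4e : 4 ∣ 2 ^ cyclotomicExponent 2 := by rw [cyclotomicExponent_two]; norm_num
  set b := ZMod.castHom (pow_dvd_pow 2 hm) (ZMod (2 ^ cyclotomicExponent 2)) a with hb
  have hcast : ZMod.castHom h4 (ZMod 4) a = ZMod.castHom h4e (ZMod 4) b := by
    rw [hb, ← RingHom.comp_apply, ZMod.castHom_comp]
  rw [hcast]
  by_cases hu : IsUnit b
  · obtain ⟨u, hu'⟩ := hu
    rw [← hu', teichWeight_units]
    rcases rootsOfUnity_torsionOrder_two_eq (teichRep 2 u) with h1 | h1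
    · -- `ω(u) = 1`, so `u = 1`
      have hu1 : u = 1 := by
        rw [← teichReduce_teichRep 2 u, h1]
        exact Units.ext (by rw [val_teichReduce]; simp)
      have hL : ((((1 : rootsOfUnity (torsionOrder 2) ℤ_[2]) : ℤ_[2]ˣ) : ℤ_[2]) : ℚ_[2]) = 1 := by simp
      rw [h1, hu1, Units.val_one, map_one, pow_one, hL, map_one, MulChar.map_one, Int.cast_one]
    · -- `ω(u) = −1`, so `u = −1`
      have hu1 : u = -1 := by
        rw [← teichReduce_teichRep 2 u, h1, teichReduce_neg_one]
      have h : ZMod.χ₄ (-1 : ZMod 4) = -1 := by decide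
      have hR : ZMod.castHom h4e (ZMod 4)
          (((-1 : (ZMod (2 ^ cyclotomicExponent 2))ˣ) : ZMod (2 ^ cyclotomicExponent 2))) = -1 := by
        rw [Units.val_neg, Units.val_one, map_neg, map_one]
      have hL : ((((⟨-1, neg_one_mem_rootsOfUnity_torsionOrder 2⟩ :
          rootsOfUnity (torsionOrder 2) ℤ_[2]) : ℤ_[2]ˣ) : ℤ_[2]) : ℚ_[2]) = -1 := by
        rw [show (((⟨-1, neg_one_mem_rootsOfUnity_torsionOrder 2⟩ :
          rootsOfUnity (torsionOrder 2) ℤ_[2]) : ℤ_[2]ˣ) : ℤ_[2]) = ((-1 : ℤ_[2]ˣ) : ℤ_[2]) from rfl,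
          Units.val_neg, Units.val_one, PadicInt.coe_neg, PadicInt.coe_one]
      rw [h1, hu1, hR, h, hL, pow_one, map_neg, map_one, Int.cast_neg, Int.cast_one]
  · -- `b` not a unit: both sides vanish
    have hb4 : ¬ IsUnit (ZMod.castHom h4e (ZMod 4) b) := by
      intro hu4
      apply hu
      -- a non-unit of `ZMod (2^{e₀})` stays a non-unit in `ZMod 4` (same radical `2`)
      rw [← ZMod.natCast_zmod_val b] at hu4 ⊢
      rw [map_natCast, ZMod.isUnit_iff_coprime] at hu4
      rw [ZMod.isUnit_iff_coprime]
      exact Nat.Coprime.pow_right _ (Nat.Coprime.coprime_dvd_right (show 2 ∣ 4 by norm_num) hu4)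
    rw [teichWeight, dif_neg hu, map_zero, MulChar.map_nonunit _ hb4, Int.cast_zero]

/-- **The odd-branch interpolation sum IS the minus twisted symbol sum of `θχ₄`**: for `θ` mod `2^{m+1}`,
`Σ_a χ_θ(a)·ι₂(ω(a))·[a/2^{m+1}]⁻_g = Σ_a χ_{θχ₄}(a)[a/2^{m+1}]⁻_g` (`χ_• ` the `ℂ₂`-twin; `χ₄ = χ₄⁻¹` and
`ι⁻¹` fixes `±1`). [cite: MazurTateTeitelbaum1986Invent, §I.13–I.14 (14.3)] -/
theorem sum_twin_mul_teichWeight_eq_ratMinusTwistedSymbolSum {m : ℕ} (hm : cyclotomicExponent 2 ≤ m + 1)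
    (h4 : 4 ∣ 2 ^ (m + 1)) (θ : DirichletCharacter ℂ (2 ^ (m + 1))) {N : ℕ} (g : CuspForm (Gamma0 N) 2) :
    ∑ a : ZMod (2 ^ (m + 1)),
        ((θ⁻¹.ringHomComp ι.symm.toRingHom).ringHomComp (algebraMap (PadicAlgCl 2) ℂ_[2])) a *
          algebraMap ℚ_[2] ℂ_[2] (teichWeight 2 1
            (ZMod.castHom (pow_dvd_pow 2 hm) (ZMod (2 ^ cyclotomicExponent 2)) a)) *
          (ratMinusSymbol g ((a.val : ℚ) / ((2 ^ (m + 1) : ℕ) : ℚ)) : ℂ_[2]) =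
      ratMinusTwistedSymbolSum g
        (((θ * DirichletCharacter.changeLevel h4 (ZMod.χ₄.ringHomComp (Int.castRingHom ℂ)))⁻¹.ringHomComp
          ι.symm.toRingHom).ringHomComp (algebraMap (PadicAlgCl 2) ℂ_[2])) := by
  rw [ratMinusTwistedSymbolSum]
  refine Finset.sum_congr rfl fun a _ ↦ ?_
  congr 1
  rw [algebraMap_teichWeight_two_one hm h4, MulChar.ringHomComp_apply, MulChar.ringHomComp_apply,
    MulChar.ringHomComp_apply, MulChar.ringHomComp_apply, mul_inv, MulChar.coeToFun_mul, Pi.mul_apply,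
    map_mul, map_mul]
  congr 1
  -- `ι₂(ι⁻¹(χ₄'(a)⁻¹)) = χ₄(a mod 4)`: an integer `0, ±1`, equal to its inverse
  rw [MulChar.inv_apply_eq_inv']
  by_cases hu : IsUnit a
  · obtain ⟨u, rfl⟩ := hu
    rw [DirichletCharacter.changeLevel_eq_cast_of_dvd, MulChar.ringHomComp_apply,
      ← ZMod.castHom_apply (h := h4) (R := ZMod 4)]
    have hval : ZMod.χ₄ (ZMod.castHom h4 (ZMod 4) (u : ZMod (2 ^ (m + 1)))) = 1 ∨
        ZMod.χ₄ (ZMod.castHom h4 (ZMod 4) (u : ZMod (2 ^ (m + 1)))) = -1 := by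
      have hu4 : IsUnit (ZMod.castHom h4 (ZMod 4) (u : ZMod (2 ^ (m + 1)))) := (Units.isUnit u).map _
      have hcases : ∀ x y : ZMod 4, x * y = 1 → ZMod.χ₄ x = 1 ∨ ZMod.χ₄ x = -1 := by decide
      obtain ⟨w, hw⟩ := hu4
      exact hcases _ _ (by rw [← hw]; exact_mod_cast w.mul_inv)
    rcases hval with h | h <;> rw [h]
    · simp
    · simp
  · have ha4 : ¬ IsUnit (DirichletCharacter.changeLevel h4 (ZMod.χ₄.ringHomComp (Int.castRingHom ℂ)) a) := by
      rw [MulChar.map_nonunit _ hu]; exact not_isUnit_zero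
    have hb4 : ¬ IsUnit (ZMod.castHom h4 (ZMod 4) a) := by
      intro hu4
      apply hu
      rw [← ZMod.natCast_zmod_val a] at hu4 ⊢
      rw [map_natCast, ZMod.isUnit_iff_coprime] at hu4
      rw [ZMod.isUnit_iff_coprime]
      exact Nat.Coprime.pow_right _ (Nat.Coprime.coprime_dvd_right (show 2 ∣ 4 by norm_num) hu4)
    rw [MulChar.map_nonunit _ hu, inv_zero, map_zero, map_zero, MulChar.map_nonunit _ hb4, Int.cast_zero]

end TwoOddPoints


end Summit.BirchSwinnertonDyer.BirchSwinnertonDyer.Theorems.PrintCf2.DisegniPairTwo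

end
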